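import Literature.NumberTheory.Automorphic.BrandtGrossPoints
import Literature.NumberTheory.EllipticCurves.GrossPoints
import HarnessLib

/-!
# Dictionary: `Brandt.IsGrossPoint` (conductor `1`, `Automorphic/BrandtGrossPoints`) versus
# `GrossRep.IsHeegner O c` / `grossPoints S K c` (any conductor, `EllipticCurves/GrossPoints`)

Topic `NumberTheory/EllipticCurves`, joining the story of `GrossPoints.lean` →
`GrossPointsPicardAction.lean` → `GrossPointsThetaElement.lean` (Heegner points of conductor `c` on a
definite Shimura set, the `Pic(𝒪_c)`-torsor, Bertolini–Darmon theta elements).  THEOREMS ONLY: no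
definition, no named fact (D-0026; net Literature debt 0).

The tree carries TWO formalisations of Gross's special points on the class set of a quaternion
order `O ⊆ D` for an embedded quadratic field `ψ : K →ₐ[ℚ] D`, over the same carriers
(`Brandt.rightIdeals`, `Brandt.leftOrder`, `Brandt.ClassSet`, `Brandt.weight`):

* `Literature.NumberTheory.Automorphic.Brandt.IsGrossPoint O ψ I` (file `BrandtGrossPoints`, item
  `defn-Brandt.toricPeriod`): conductor `1` only — `I ∈ rightIdeals O`, `ψ(𝓞_K) ⊆ O_L(I)` optimally;
  translates `Brandt.grossTranslate ψ J I = ψ(J) I` by ideals `J ⊆ 𝓞_K`, classes acting through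
  `IsGrossPoint.act : ClassGroup (𝓞 K) → ClassSet O`, values through `Brandt.evalAtLattice`;
* `Literature.NumberTheory.EllipticCurves.GrossRep.IsHeegner O c ⟨ψ, I⟩` (file `GrossPoints`, item
  `defn-GrossPointsThetaElement`): ANY conductor `c` — `I ∈ rightIdeals O` and
  `ψ x ∈ O_L(I) ↔ x ∈ quadOrder K c = ℤ + c𝓞_K`; points `grossPoints S K c ⊆ GrossSpace S.D K`, the
  lattice action `𝔞 • ⟨ψ, I⟩ = ⟨ψ, ψ(𝔞) I⟩` and, in the sequel files, the `Pic(𝒪_c)`-action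
  `GrossSpace.picardMulAction c`, towers `GrossPointTower S p` and theta elements.

This file records the (definitional) dictionary between the two, so that statements based at a
conductor-`1` point in the first vocabulary (e.g. the `F1Sign2` Gaussian rows of
`Summits/BirchSwinnertonDyer/Rank1Residual/F1Sign2/DefiniteMod2WaldspurgerGaussianAtTwo.lean`, all
hypothesised on `Brandt.IsGrossPoint S.O ψ I`) can use the conductor-`c` machinery of the second:

* §1 lattices: `brandtEmbLattice_eq_embLattice_restrictScalars` (`Brandt.embLattice ψ M` is
  `GrossRep.embLattice ψ M|_ℤ`), `imageLattice_eq_embLattice_restrictScalars`,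
  **`grossTranslate_eq_lattice_smul_lat`** (Gross's translate `ψ(J) I` IS the lattice action of the
  `ℤ`-lattice of `J` on the pair `⟨ψ, I⟩`);
* §2 points: `mem_quadOrder_one_iff` (`x ∈ 𝒪_1 ↔ x ∈ 𝓞_K`), **`isGrossPoint_iff_isHeegner_one`**
  (`Brandt.IsGrossPoint O ψ I ↔ GrossRep.IsHeegner O 1 ⟨ψ, I⟩`), **`mk_mem_grossPoints_one_iff`**
  (`[⟨ψ, I⟩] ∈ grossPoints K S 1 ↔ Brandt.IsGrossPoint S.O ψ I`);
* §3 values: **`yValue_eq_unitIndex_mul_evalAtLattice`** (`⟨(ψ, I), φ⟩ = w(O_L(I)) · φ[I]` with the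
  weight computed on `I` itself, `Brandt.weight_mk`; junk `0` off `rightIdeals O` on both sides).

Sources: B. H. Gross, *Heights and the special values of L-series* (1987) §3 (special points
`(f, R_i)`, `f` an optimal embedding, the free action of `Pic(𝒪)`); M. Bertolini, H. Darmon,
*Heegner points on Mumford–Tate curves*, Invent. Math. 126 (1996) §2.1 (optimal embeddings of the
order of conductor `c`), §2.3 (4) (the action of `Pic(𝒪_c)`); every statement below is a definitional
unfolding of the two tree files, cited to the passage of the source whose notion both sides formalise.

## Mathlib / tree search

`lean search 'IsGrossPoint'` → `Automorphic/BrandtGrossPoints.lean` (conductor 1),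
`Automorphic/BrandtCuspidalTypeForms.lean` (`IsGrossPointOfConductorLite`, the `Subring`/explicit
`QuaternionAlgebra` vocabulary of the `…Lite` files — not bridged here); `lean search 'IsHeegner|quadOrder'`
→ `EllipticCurves/GrossPoints*.lean`; no existing lemma mentions both `IsGrossPoint` and `IsHeegner`
(`rg 'IsHeegner.*IsGrossPoint|IsGrossPoint.*IsHeegner'` over `Literature/`, `Summits/`: 0 hits).

## References

* [Gross1987] B. H. Gross, *Heights and the special values of L-series*, CMS Conf. Proc. 7 (1987), §3.
* [BertoliniDarmon1996] M. Bertolini, H. Darmon, *Heegner points on Mumford–Tate curves*, Invent.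
  Math. 126 (1996) 413–456, §2.1, §2.3.
-/

noncomputable section

open scoped Pointwise nonZeroDivisors
open NumberField Literature.NumberTheory.Automorphic

universe u v

namespace Literature.NumberTheory.EllipticCurves

variable {D : Type v} [Ring D] [Algebra ℚ D] {K : Type u} [Field K] [NumberField K]

/-! ### §1 Lattices: `Brandt.embLattice` / `Brandt.imageLattice` / `Brandt.grossTranslate` versus
`GrossRep.embLattice` and the lattice action -/

/-- `Brandt.embLattice ψ M` (image of an `𝓞_K`-submodule `M ⊆ K`) is `GrossRep.embLattice ψ` of the
underlying `ℤ`-lattice `M|_ℤ` (both are `Submodule.map` along `ψ` as a `ℤ`-linear map): the lattice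
`f(𝔞) ⊆ B` of BD96's action (4). [cite: BertoliniDarmon1996, §2.3 (4)] -/
theorem brandtEmbLattice_eq_embLattice_restrictScalars (ψ : K →ₐ[ℚ] D) (M : Submodule (𝓞 K) K) :
    Brandt.embLattice ψ M = GrossRep.embLattice ψ (M.restrictScalars ℤ) :=
  rfl

/-- `Brandt.imageLattice ψ J = ℤ⟨ψ(J)⟩` for an ideal `J ⊆ 𝓞_K` is `GrossRep.embLattice ψ` of the
`ℤ`-lattice of `J` in `K` (the fractional ideal `J ⊆ K` with scalars restricted to `ℤ`) — Gross's
`ψ(𝔞)` entering the translate `ψ(𝔞) I` of a special point (Gross 1987 §3). [cite: Gross1987, §3] -/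
theorem imageLattice_eq_embLattice_restrictScalars (ψ : K →ₐ[ℚ] D) (J : Ideal (𝓞 K)) :
    Brandt.imageLattice ψ J =
      GrossRep.embLattice ψ
        ((((J : FractionalIdeal (𝓞 K)⁰ K) : Submodule (𝓞 K) K)).restrictScalars ℤ) := by
  rw [Brandt.imageLattice_eq_embLattice_coeIdeal]
  rfl

/-- **Gross's translate is the lattice action**: `Brandt.grossTranslate ψ J I = ψ(J) I` is the
lattice of `𝔧 • ⟨ψ, I⟩`, `𝔧 ⊆ K` the `ℤ`-lattice of the ideal `J ⊆ 𝓞_K` (`GrossRep.latticeSMul`: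
`𝔞 • (f, I) = (f, f(𝔞) I)`, BD96 §2.3 (4) at `c = 1`). [cite: BertoliniDarmon1996, §2.3 (4)] -/
theorem grossTranslate_eq_lattice_smul_lat (ψ : K →ₐ[ℚ] D) (J : Ideal (𝓞 K)) (I : Submodule ℤ D) :
    Brandt.grossTranslate ψ J I =
      ((((J : FractionalIdeal (𝓞 K)⁰ K) : Submodule (𝓞 K) K).restrictScalars ℤ) •
          (⟨ψ, I⟩ : GrossRep D K)).lat := by
  rw [GrossRep.lattice_smul_lat, Brandt.grossTranslate, imageLattice_eq_embLattice_restrictScalars]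

/-! ### §2 Points: `Brandt.IsGrossPoint O ψ I` is `GrossRep.IsHeegner O 1 ⟨ψ, I⟩` -/

omit [NumberField K] in
/-- `x ∈ 𝒪_1 = ℤ + 1·𝓞_K` iff `x ∈ 𝓞_K`, i.e. iff `x` is in the range of `𝓞_K → K`
(`quadOrder_one : quadOrder K 1 = integralClosure ℤ K`; BD96 §2.1: `𝒪 = ℤ[cω]` with `c = 1` is the
maximal order `ℤ[ω] = 𝓞_K`). [cite: BertoliniDarmon1996, §2.1] -/
theorem mem_quadOrder_one_iff (x : K) : x ∈ quadOrder K 1 ↔ x ∈ (algebraMap (𝓞 K) K).range := by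
  rw [quadOrder_one, RingHom.mem_range]
  constructor
  · intro hx
    exact ⟨⟨x, hx⟩, rfl⟩
  · rintro ⟨y, rfl⟩
    exact y.2

/-- **The dictionary on points**: `(ψ, I)` is a Gross point of conductor `1` in the sense of
`BrandtGrossPoints` (`I ∈ rightIdeals O`, `ψ(𝓞_K) ⊆ O_L(I)`, `ψ⁻¹(O_L(I)) ⊆ 𝓞_K`) iff `⟨ψ, I⟩` is a
Heegner representative of conductor `1` in the sense of `GrossPoints` (`I ∈ rightIdeals O`,
`ψ x ∈ O_L(I) ↔ x ∈ 𝒪_1`). (Gross 1987 §3: special points = optimal embeddings `𝒪 → R_i`; BD96 §2.1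
at `c = 1`.) [cite: BertoliniDarmon1996, §2.1] -/
theorem isGrossPoint_iff_isHeegner_one {O : Submodule ℤ D} {ψ : K →ₐ[ℚ] D} {I : Submodule ℤ D} :
    Brandt.IsGrossPoint O ψ I ↔ GrossRep.IsHeegner O 1 (⟨ψ, I⟩ : GrossRep D K) := by
  rw [Brandt.isGrossPoint_iff]
  change _ ↔ I ∈ Brandt.rightIdeals O ∧ ∀ x : K, ψ x ∈ Brandt.leftOrder I ↔ x ∈ quadOrder K 1
  refine and_congr_right fun _ => ⟨?_, ?_⟩
  · rintro ⟨hmem, hopt⟩ x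
    rw [mem_quadOrder_one_iff]
    refine ⟨hopt x, ?_⟩
    rintro ⟨y, rfl⟩
    exact hmem y
  · intro h
    refine ⟨fun y => (h _).mpr ((mem_quadOrder_one_iff _).mpr ⟨y, rfl⟩), fun x hx => ?_⟩
    exact (mem_quadOrder_one_iff x).mp ((h x).mp hx)

/-- From a `BrandtGrossPoints` Gross point to a conductor-`1` Heegner representative (an optimal
embedding of `𝒪_1 = 𝓞_K`, BD96 §2.1). [cite: BertoliniDarmon1996, §2.1] -/
theorem _root_.Literature.NumberTheory.Automorphic.Brandt.IsGrossPoint.isHeegner_one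
    {O : Submodule ℤ D} {ψ : K →ₐ[ℚ] D} {I : Submodule ℤ D} (h : Brandt.IsGrossPoint O ψ I) :
    GrossRep.IsHeegner O 1 (⟨ψ, I⟩ : GrossRep D K) :=
  isGrossPoint_iff_isHeegner_one.mp h

/-- From a conductor-`1` Heegner representative `r = (f, I)` (BD96 §2.1) to a `BrandtGrossPoints`
Gross point `(r.emb, r.lat)` (Gross 1987 §3, special point with `f` optimal on `𝓞_K`). [cite: Gross1987, §3] -/
theorem GrossRep.IsHeegner.isGrossPoint {O : Submodule ℤ D} {r : GrossRep D K}
    (h : r.IsHeegner O 1) : Brandt.IsGrossPoint O r.emb r.lat :=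
  isGrossPoint_iff_isHeegner_one.mpr h

/-- **On the definite Shimura set of a Brandt set-up**: the class `[⟨ψ, I⟩] ∈ GrossSpace S.D K` is a
Gross point of conductor `1` (`grossPoints K S 1`, BD96's `H_{N⁺,N⁻}(K, 1)`) iff
`Brandt.IsGrossPoint S.O ψ I`. [cite: BertoliniDarmon1996, §2.1] -/
theorem mk_mem_grossPoints_one_iff {Nplus Nminus : ℕ} (S : Brandt.XiSetup Nplus Nminus)
    {ψ : K →ₐ[ℚ] S.D} {I : Submodule ℤ S.D} :
    GrossSpace.mk (⟨ψ, I⟩ : GrossRep S.D K) ∈ grossPoints K S 1 ↔ Brandt.IsGrossPoint S.O ψ I := by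
  rw [mk_mem_grossPoints_iff, isGrossPoint_iff_isHeegner_one]

/-- A `BrandtGrossPoints` Gross point of a Brandt set-up gives a point of `grossPoints K S 1`; in
particular it is `𝒪_1`-saturated and the `Pic(𝒪_c)`-actions of `GrossPointsPicardAction` apply to
it (BD96 §2.1: the Heegner points `H_{N⁺,N⁻}(K, 1)`). [cite: BertoliniDarmon1996, §2.1] -/
theorem _root_.Literature.NumberTheory.Automorphic.Brandt.IsGrossPoint.mk_mem_grossPoints_one
    {Nplus Nminus : ℕ} {S : Brandt.XiSetup Nplus Nminus} {ψ : K →ₐ[ℚ] S.D} {I : Submodule ℤ S.D}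
    (h : Brandt.IsGrossPoint S.O ψ I) :
    GrossSpace.mk (⟨ψ, I⟩ : GrossRep S.D K) ∈ grossPoints K S 1 :=
  (mk_mem_grossPoints_one_iff S).mpr h

/-! ### §3 Values: `GrossRep.yValue` versus `Brandt.evalAtLattice` -/

/-- **The dictionary on values**: `⟨(f, I), φ⟩ = w_[I] · φ[I]` (`GrossRep.yValue`, weight of the CLASS)
equals `w(O_L(I)) · φ[I]` with the weight `Brandt.unitIndex (Brandt.leftOrder I)` computed on `I`
itself and the value taken through `Brandt.evalAtLattice` (junk `0` off `rightIdeals O` on both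
sides); the weight `w_i = |O_iˣ/{±1}|` is a class function (`Brandt.weight_mk`, Voight 41.1.3), and
`⟨e_c, e_d⟩ = w_c δ_{cd}` is Gross's pairing, BD96 §1.4/§1.9 `φ_E^*(P) = ⟨P, v_f⟩`.
[cite: Voight2021, 41.1.3] [cite: BertoliniDarmon1996, §1.9] -/
theorem yValue_eq_unitIndex_mul_evalAtLattice {O : Submodule ℤ D} (φ : Brandt.ClassSet O → ℤ)
    (r : GrossRep D K) :
    r.yValue O φ = (Brandt.unitIndex (Brandt.leftOrder r.lat) : ℤ) * Brandt.evalAtLattice φ r.lat := by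
  by_cases h : r.lat ∈ Brandt.rightIdeals O
  · rw [GrossRep.yValue_eq φ h, Brandt.evalAtLattice_of_mem φ h, Brandt.weight_mk O ⟨r.lat, h⟩]
  · rw [GrossRep.yValue_of_not_mem φ h, Brandt.evalAtLattice_of_not_mem φ h, mul_zero]

/-- The same for the pair `⟨ψ, J⟩` built from a lattice `J` (the form in which values of CM
sub-lattices `J ⊆ I` are written lattice-theoretically): `⟨(ψ, J), φ⟩ = w(O_L(J)) · φ[J]`
(BD96 §1.9, weight on `J` by Voight 41.1.3). [cite: BertoliniDarmon1996, §1.9] -/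
theorem yValue_mk_eq_unitIndex_mul_evalAtLattice {O : Submodule ℤ D} (φ : Brandt.ClassSet O → ℤ)
    (ψ : K →ₐ[ℚ] D) (J : Submodule ℤ D) :
    (⟨ψ, J⟩ : GrossRep D K).yValue O φ =
      (Brandt.unitIndex (Brandt.leftOrder J) : ℤ) * Brandt.evalAtLattice φ J :=
  yValue_eq_unitIndex_mul_evalAtLattice φ ⟨ψ, J⟩

end Literature.NumberTheory.EllipticCurves

end
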